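import Summits.BirchSwinnertonDyer.BirchSwinnertonDyer.Theorems.EisensteinPrimesBSDpOnCellCTelescopeK2FrobeniusAnnihilator
import Summits.BirchSwinnertonDyer.BirchSwinnertonDyer.Theorems.EisensteinPrimesBSDpOnCellCTelescopeK2InvariantsQuotToH1
import Summits.BirchSwinnertonDyer.BirchSwinnertonDyer.Theorems.EisensteinPrimesBSDpOnCellCTelescopeK2HOneInertiaQuasiIso
import Summits.BirchSwinnertonDyer.BirchSwinnertonDyer.Theorems.EisensteinPrimesBSDpOnCellCTelescopeK2WeightTwoControlMapOfFrobenius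
import Literature.NumberTheory.GaloisRepresentations.ContinuousCohomologyAdditiveTransport
import Literature.NumberTheory.EllipticCurves.SelmerCocycleLiftUnramifiedFiniteProofs
import Literature.NumberTheory.IwasawaTheory.Greenberg2006.CofiniteGenerationCriterion
import Literature.NumberTheory.EllipticCurves.ZpExtensionUnramifiedProofs
import Mathlib.NumberTheory.Padics.RingHoms
import HarnessLib

/-!
# Crux 4 `BSDpOnCellC` (stmt-BirchSwinnertonDyer-19034), line «telescope» v10, leaves N2|pub (W2) AND N3′ — the Frobenius-annihilator input
# for a GENERAL fibre `A₂[c]` (`c = X` for W2, `c = X − x_k` for N3′) quasi-isomorphic to ANY `p`-divisible discrete module with finite `p`-torsion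
# (successor LEAD `cruxlead-19034` g3; `--supports`, helper; THEOREMS ONLY; closes no registered stub)

HONEST FRAMING. No registered stub, no crux, no summit statement is proved; BSD is proved for no curve. This is the two-parameter generalisation
of `TelescopeK2HOneInertiaCofinite.module_finite_characterModule_h1_absInertia` (there `c = X`) and of
`TelescopeK2FrobeniusAnnihilatorOfFibre.frobeniusAnnihilator_of_representation` (there `c = X`, target `E[p^∞]`): the scalar `c ∈ ℤ_p⟦X⟧` is any
element with `𝔪 ≤ (p) + (c)` (so `c = X - C x` for every `x ∈ pℤ_p`, by `TelescopeK2HOneInertiaCofinite.maximalIdeal_le_span_sup_span` and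
`X = (X - C x) + C x`), and the target of the fibre map is any discrete `p`-primary, `p`-divisible `Γ_K`-module `T` with `T[p]` finite over any
coefficient ring (for N3′: the cofree member module `A_{g_k}† = Cofree (D k).Δ.selfDualRep …`). Same chain: p755236 ∘ p755760 ∘ p756773 ∘ (this
file's criterion) with the discrete topology on `ℤ_p⟦X⟧` chosen inside the proof.

* **`module_finite_characterModule_h1_absInertia_of_smul_eq_zero`** — Greenberg's criterion for `H¹(I_F, D)` when `c • D = 0`, `𝔪 ≤ (p) + (c)`.
* **`frobeniusAnnihilator_of_quasiIso`** — `∃ P` monic with `P(σR(res d)) · A^{I_w} ⊆ c · A^{I_w}`, from `c`-divisibility of `A` and a quasi-iso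
  `θ : A[c] → T` (finite kernel and cokernel) into a `p`-primary `p`-divisible `T` with `T[p]` finite.

References: Jetchev–Skinner–Wan, Camb. J. Math. 5 (2017) §3.4 [JetchevSkinnerWan2017]; R. Greenberg, Doc. Math. Extra Vol. (2006) §3 A [Greenberg2006];
J.-P. Serre, Cohomologie galoisienne, I §2.2 [SerreGaloisCohomology1997]; J. Milne, ADT I §2 Lemma 2.9 [MilneADT2006].
-/

set_option autoImplicit false
set_option linter.dupNamespace false

noncomputable section

open CategoryTheory Function
open scoped Pointwise Valued
open Field ValuativeRel IsLocalRing IsDedekindDomain NumberField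

open Literature.NumberTheory.GaloisRepresentations Literature.NumberTheory.GaloisRepresentations.IsNonarchimedeanLocalField
  Literature.NumberTheory.IwasawaTheory.Greenberg2006
  Literature.NumberTheory.EllipticCurves Literature.NumberTheory.EllipticCurves.BigGaloisRep

namespace Summit.BirchSwinnertonDyer.BirchSwinnertonDyer.Theorems.TelescopeK2FrobeniusAnnihilatorOfQuasiIso

open Summit.BirchSwinnertonDyer.BirchSwinnertonDyer.Theorems

section Criterion

variable {F : Type} [Field F] [ValuativeRel F] [TopologicalSpace F] [IsNonarchimedeanLocalField F]

/-- **`H¹(I_F, D)^∨` is finitely generated over `ℤ_p⟦X⟧`** — `D` a discrete continuous `Γ_F`-representation over `ℤ_p⟦X⟧` killed by an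
element `c` with `𝔪 ≤ (p) + (c)` (e.g. `c = X - x` with `x ∈ pℤ_p`) and `p`-primary, whose inertia cohomology with `ℤ`-coefficients has finite
`p`-torsion (generalises `TelescopeK2HOneInertiaCofinite.module_finite_characterModule_h1_absInertia`, the case `c = X`). [cite: Greenberg2006, §3 A
(proof of Prop. 3.2)]
[cite: SerreGaloisCohomology1997, I §2.2] -/
theorem module_finite_characterModule_h1_absInertia_of_smul_eq_zero {p : ℕ} [Fact p.Prime] {m : ℕ}
    (e : PowerSeries ℤ_[p] ≃+* MvPowerSeries (Fin m) ℤ_[p])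
    [TopologicalSpace (PowerSeries ℤ_[p])]
    {D : Type} [AddCommGroup D] [Module (PowerSeries ℤ_[p]) D] [TopologicalSpace D] [DiscreteTopology D]
    [ContinuousSMul (PowerSeries ℤ_[p]) D]
    (ρ : ContinuousRep (absoluteGaloisGroup F) (PowerSeries ℤ_[p]) D)
    (ρZ : ContinuousRep (absoluteGaloisGroup F) ℤ D) (hρZ : ∀ (g : absoluteGaloisGroup F) (x : D), ρZ g x = ρ g x)
    (c : PowerSeries ℤ_[p])
    (hc𝔪 : maximalIdeal (PowerSeries ℤ_[p]) ≤
      Ideal.span {((p : ℕ) : PowerSeries ℤ_[p])} ⊔ Ideal.span {c})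
    (hX : ∀ d : D, c • d = 0) (hp : ∀ d : D, ∃ k : ℕ, p ^ k • d = 0)
    (hfin : Finite (Submodule.torsionBy ℤ
      (continuousCohomology 1 ((ρZ.restrict (Literature.NumberTheory.GaloisRepresentations.subgroupIncl (absInertia F))).toTopRep)) (p : ℤ))) :
    Module.Finite (PowerSeries ℤ_[p])
      (CharacterModule (continuousCohomology 1 ((ρ.restrict (Literature.NumberTheory.GaloisRepresentations.subgroupIncl (absInertia F))).toTopRep))) := by
  classical
  haveI : CompactSpace (absoluteGaloisGroup F) := absoluteGaloisGroup_compactSpace F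
  haveI : CompactSpace (absInertia F) :=
    isCompact_iff_compactSpace.mp (isClosed_absInertia_holds F).isCompact
  set XS := (ρ.restrict (Literature.NumberTheory.GaloisRepresentations.subgroupIncl (absInertia F))).toTopRep with hXS
  set XZ := (ρZ.restrict (Literature.NumberTheory.GaloisRepresentations.subgroupIncl (absInertia F))).toTopRep with hXZ
  -- the cohomology groups with `ℤ_p⟦X⟧`- and with `ℤ`-coefficients agree additively
  let η : (XS : Type) ≃ₜ+ (XZ : Type) := ContinuousAddEquiv.refl D
  have hη : ∀ (g : absInertia F) (x : XS), η (XS.ρ g x) = XZ.ρ g (η x) := fun g x => (hρZ _ x).symm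
  let e₁ : (continuousCohomology 1 XS : Type) ≃+ (continuousCohomology 1 XZ : Type) := continuousCohomologyAddEquiv η hη 1
  -- every class is killed by `X` and by a power of `p`
  have hXH : ∀ y : continuousCohomology 1 XS, c • y = 0 := by
    intro y
    obtain ⟨z, rfl⟩ := oneCocycleClass_surjective _ y
    exact Literature.NumberTheory.EllipticCurves.BigGaloisRep.oneCocycleClass_smul_eq_zero_of_forall _ _ z fun g => hX _
  have hpD : ∀ d : (XS : Type), ∃ k : ℕ, ((p : ℕ) : PowerSeries ℤ_[p]) ^ k • d = 0 := fun d => by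
    obtain ⟨k, hk⟩ := hp d
    exact ⟨k, by rw [← Nat.cast_pow, Nat.cast_smul_eq_nsmul]; exact hk⟩
  have hpH : ∀ c : continuousCohomology 1 XS, ∃ k : ℕ, ((p : ℕ) : PowerSeries ℤ_[p]) ^ k • c = 0 :=
    fun c => Literature.NumberTheory.EllipticCurves.BigGaloisRep.exists_pow_smul_eq_zero XS _ hpD c
  -- `𝔪`-power torsion
  have htors : ∀ c : continuousCohomology 1 XS, ∃ k : ℕ, ∀ r ∈ maximalIdeal (PowerSeries ℤ_[p]) ^ k, r • c = 0 := by
    intro c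
    obtain ⟨k, hk⟩ := hpH c
    refine ⟨k + 1, fun r hr => ?_⟩
    have hle := Ideal.pow_right_mono hc𝔪 (k + 1)
    have hr' := Ideal.sup_pow_add_le_pow_sup_pow (hle hr)
    rw [Ideal.span_singleton_pow, pow_one] at hr'
    obtain ⟨a, ha, b, hb, rfl⟩ := Submodule.mem_sup.1 hr'
    obtain ⟨s, rfl⟩ := Ideal.mem_span_singleton'.1 ha
    obtain ⟨t, rfl⟩ := Ideal.mem_span_singleton'.1 hb
    rw [add_smul, mul_smul, hk, smul_zero, mul_smul, hXH, smul_zero, add_zero]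
  -- `H¹[𝔪]` is finite: it lies in `H¹[p]`, which injects into the finite `p`-torsion of the `ℤ`-coefficient cohomology
  haveI := hfin
  have hpfin : Set.Finite {c : continuousCohomology 1 XS | ((p : ℕ) : PowerSeries ℤ_[p]) • c = 0} := by
    refine Set.Finite.of_injOn (f := fun c => e₁ c) (fun c hc => ?_) (e₁.injective.injOn) (Set.toFinite
      ((Submodule.torsionBy ℤ (continuousCohomology 1 XZ) (p : ℤ) : Submodule ℤ (continuousCohomology 1 XZ)) :
        Set (continuousCohomology 1 XZ)))
    rw [Set.mem_setOf_eq, Nat.cast_smul_eq_nsmul] at hc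
    rw [SetLike.mem_coe, Submodule.mem_torsionBy_iff, Nat.cast_smul_eq_nsmul, ← map_nsmul, hc, map_zero]
  haveI : Finite (Submodule.torsionBySet (PowerSeries ℤ_[p]) (continuousCohomology 1 XS)
      (maximalIdeal (PowerSeries ℤ_[p]) : Set (PowerSeries ℤ_[p]))) := by
    refine Set.finite_coe_iff.mpr (hpfin.subset fun c hc => ?_)
    rw [SetLike.mem_coe, Submodule.mem_torsionBySet_iff] at hc
    have hpm : ((p : ℕ) : PowerSeries ℤ_[p]) ∈ (maximalIdeal (PowerSeries ℤ_[p]) : Set (PowerSeries ℤ_[p])) := by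
      rw [SetLike.mem_coe, mem_maximalIdeal, mem_nonunits_iff, PowerSeries.isUnit_iff_constantCoeff, map_natCast]
      intro h
      exact (PadicInt.norm_lt_one_iff_dvd _ |>.mpr (dvd_refl (p : ℤ_[p])) |>.ne) (PadicInt.isUnit_iff.mp h)
    exact hc ⟨_, hpm⟩
  exact isCofinitelyGenerated_iff_module_finite_characterModule.mp
    (isCofinitelyGenerated_of_finite_torsionBy_maximalIdeal e htors)


end Criterion

set_option maxHeartbeats 800000 in
/-- **Frobenius annihilator modulo `c` from a quasi-isomorphism of the fibre `A[c]` with a `p`-divisible module.** `σR : Γ_K → Aut_{ℤ_p⟦X⟧}(A)`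
a representation with jointly continuous action on the discrete `A`, `c ∈ ℤ_p⟦X⟧` with `𝔪 ≤ (p) + (c)` acting SURJECTIVELY on `A`, `T` a discrete
`p`-primary `p`-divisible `Γ_K`-module over any coefficient ring `R` with `T[p]` finite, `θ : A[c] → T` additive, `Γ_K`-equivariant, with finite
kernel and finite cokernel, `w ∤ p`, `d ∈ Γ_{K_w}`: there is a MONIC `P ∈ ℤ_p⟦X⟧[Y]` with `P(σR(res d)) · A^{I_w} ⊆ c · A^{I_w}` (quantifier shape of
x2-p2's (ann)). The case `c = X`, `T = E[p^∞]` is `TelescopeK2FrobeniusAnnihilatorOfFibre.frobeniusAnnihilator_of_representation`; the case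
`c = X - C x_k`, `T = A_{g_k}†` is the (ann)-type input of leaf N3′. The topology on `ℤ_p⟦X⟧` is chosen discrete inside the proof.
[cite: JetchevSkinnerWan2017, §3.4] [cite: Greenberg2006, §3 A] [cite: SerreGaloisCohomology1997, I §2.2] -/
theorem frobeniusAnnihilator_of_quasiIso {K : Type} [Field K] [NumberField K] {p : ℕ} [Fact p.Prime]
    {R : Type*} [CommRing R] [TopologicalSpace R] {T : Type} [AddCommGroup T] [Module R T] [TopologicalSpace T] [DiscreteTopology T]
    (ρT : ContinuousRep (absoluteGaloisGroup K) R T)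
    (hTprim : ∀ t : T, ∃ k : ℕ, p ^ k • t = 0) (hTdiv : ∀ t : T, ∃ s : T, p • s = t)
    [Finite (Submodule.torsionBy ℤ T (p : ℤ))]
    {A₂ : Type} [AddCommGroup A₂] [Module (PowerSeries ℤ_[p]) A₂] [TopologicalSpace A₂] [DiscreteTopology A₂]
    (σR : Representation (PowerSeries ℤ_[p]) (absoluteGaloisGroup K) A₂)
    (hσ : Continuous fun q : absoluteGaloisGroup K × A₂ => σR q.1 q.2)
    (c : PowerSeries ℤ_[p])
    (hc𝔪 : IsLocalRing.maximalIdeal (PowerSeries ℤ_[p]) ≤ Ideal.span {((p : ℕ) : PowerSeries ℤ_[p])} ⊔ Ideal.span {c})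
    (hcof : ∀ a : A₂, ∃ b : A₂, c • b = a)
    (θ₀ : Submodule.torsionBy (PowerSeries ℤ_[p]) A₂ c →+ T)
    (hθσ : ∀ (g : absoluteGaloisGroup K) (a : Submodule.torsionBy (PowerSeries ℤ_[p]) A₂ c)
      (hga : σR g (a : A₂) ∈ Submodule.torsionBy (PowerSeries ℤ_[p]) A₂ c),
      θ₀ ⟨σR g (a : A₂), hga⟩ = ρT g (θ₀ a))
    (hker : Finite θ₀.ker) (hcoker : Finite (T ⧸ θ₀.range))
    (w : HeightOneSpectrum (𝓞 K)) (hpw : ((p : ℕ) : 𝓞 K) ∉ w.asIdeal) (d : LocalGroup K (Sum.inl w)) :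
    ∃ P : Polynomial (PowerSeries ℤ_[p]), P.Monic ∧
      ∀ a : A₂, (∀ h : LocalGroup K (Sum.inr w), σR (localMap K (Sum.inr w) h) a = a) →
        ∃ a₀ : A₂, (∀ h : LocalGroup K (Sum.inr w), σR (localMap K (Sum.inr w) h) a₀ = a₀) ∧
          c • a₀ = (Polynomial.aeval (σR (localMap K (Sum.inl w) d)) P) a := by
  classical
  -- the discrete topology on the coefficients
  letI : TopologicalSpace (PowerSeries ℤ_[p]) := ⊥
  haveI : DiscreteTopology (PowerSeries ℤ_[p]) := ⟨rfl⟩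
  haveI : ContinuousSMul (PowerSeries ℤ_[p]) A₂ := ⟨continuous_of_discreteTopology⟩
  let ρ : ContinuousRep (absoluteGaloisGroup K) (PowerSeries ℤ_[p]) A₂ := ⟨σR, hσ⟩
  -- the fibre `D = A₂[X]` and its representations
  haveI : ContinuousSMul (PowerSeries ℤ_[p]) (Submodule.torsionBy (PowerSeries ℤ_[p]) A₂ c) :=
    ⟨continuous_of_discreteTopology⟩
  let ρD : ContinuousRep (absoluteGaloisGroup K) (PowerSeries ℤ_[p])
      (Submodule.torsionBy (PowerSeries ℤ_[p]) A₂ c) := torsionRep ρ c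
  let ρDw := ρD.restrict (absGaloisRestrict K (w.adicCompletion K))
  let ρZ : ContinuousRep (absoluteGaloisGroup (w.adicCompletion K)) ℤ
      (Submodule.torsionBy (PowerSeries ℤ_[p]) A₂ c) :=
    { toRepresentation :=
        { toFun := fun g => (ρDw g).toAddMonoidHom.toIntLinearMap
          map_one' := LinearMap.ext fun x => by
            change ρDw 1 x = x
            rw [map_one]; rfl
          map_mul' := fun g h => LinearMap.ext fun x => by
            change ρDw (g * h) x = ρDw g (ρDw h x)
            rw [map_mul]; rfl }
      continuous_smul := ρDw.continuous_smul }
  have hρZ : ∀ (g : absoluteGaloisGroup (w.adicCompletion K))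
      (x : Submodule.torsionBy (PowerSeries ℤ_[p]) A₂ c), ρZ g x = ρDw g x := fun _ _ => rfl
  let ρEw := ρT.restrict (absGaloisRestrict K (w.adicCompletion K))
  let ρEZ : ContinuousRep (absoluteGaloisGroup (w.adicCompletion K)) ℤ T :=
    { toRepresentation :=
        { toFun := fun g => (ρEw g).toAddMonoidHom.toIntLinearMap
          map_one' := LinearMap.ext fun x => by
            change ρEw 1 x = x
            rw [map_one]; rfl
          map_mul' := fun g h => LinearMap.ext fun x => by
            change ρEw (g * h) x = ρEw g (ρEw h x)
            rw [map_mul]; rfl }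
      continuous_smul := ρEw.continuous_smul }
  -- `θ₀` as a morphism of the `ℤ`-representations of `Γ_{K_w}`
  let f : ρZ.toTopRep ⟶ ρEZ.toTopRep :=
    TopRep.ofHom
      { toLinearMap := θ₀.toIntLinearMap
        cont := continuous_of_discreteTopology
        isIntertwining' := fun γ => by
          refine ContinuousLinearMap.ext fun a => ?_
          change θ₀ (ρDw γ a) = ρEw γ (θ₀ a)
          exact hθσ (absGaloisRestrict K (w.adicCompletion K) γ) a _ }
  have hf : ∀ a, f.hom a = θ₀ a := fun _ => rfl
  -- kernel and cokernel of `f` are those of `θ₀`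
  have hker' : Finite (LinearMap.ker f.hom.toLinearMap) := by
    haveI := hker
    exact Finite.of_equiv θ₀.ker (Equiv.subtypeEquivRight fun x => Iff.rfl)
  have hcoker' : Finite (T ⧸ LinearMap.range f.hom.toLinearMap) := by
    haveI := hcoker
    have hle : θ₀.range ≤ (LinearMap.range f.hom.toLinearMap).toAddSubgroup := by
      rintro _ ⟨a, rfl⟩
      exact ⟨a, rfl⟩
    refine Finite.of_surjective (QuotientAddGroup.map θ₀.range (LinearMap.range f.hom.toLinearMap).toAddSubgroup
      (AddMonoidHom.id _) hle) fun q => ?_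
    induction q using QuotientAddGroup.induction_on with
    | H e => exact ⟨QuotientAddGroup.mk e, rfl⟩
  -- `p` is prime to the residue characteristic of `K_w`
  have hp := (Nat.coprime_primes (Fact.out : p.Prime) (ringChar_residueField_prime (F := w.adicCompletion K))).mpr
    (Ne.symm (w.ringChar_residueField_adicCompletion_ne hpw))
  -- `D` is `p`-primary (finite kernel of `θ₀`, `T` `p`-primary)
  have hD : ∀ dd : Submodule.torsionBy (PowerSeries ℤ_[p]) A₂ c, ∃ k : ℕ, p ^ k • dd = 0 := by
    intro dd
    haveI := hker
    obtain ⟨k, hk'⟩ := hTprim (θ₀ dd)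
    have hmem : p ^ k • dd ∈ θ₀.ker := by rw [AddMonoidHom.mem_ker, map_nsmul, hk']
    have hfin : IsOfFinAddOrder dd := by
      rw [isOfFinAddOrder_iff_nsmul_eq_zero]
      refine ⟨Nat.card θ₀.ker * p ^ k, Nat.mul_pos Nat.card_pos (pow_pos (Fact.out : p.Prime).pos k), ?_⟩
      rw [mul_comm, mul_nsmul]
      have h1 := card_nsmul_eq_zero' (G := θ₀.ker) (x := ⟨p ^ k • dd, hmem⟩)
      exact congrArg Subtype.val h1
    exact TelescopeK2WeightTwoControlMapOfFrobenius.exists_pow_smul_eq_zero_of_isOfFinAddOrder hfin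
  -- brick 4: `H¹(I_w, D_ℤ)[p]` is finite
  have hfinZ := TelescopeK2HOneInertiaQuasiIso.finite_setOf_smul_eq_zero_h1_absInertia_of_hom (w.adicCompletion K)
    ρZ ρEZ f hker' hcoker' hp hD hTdiv
  -- brick 5: `H¹(I_w, D)^∨` is finitely generated over `ℤ_p⟦X⟧`
  have e : PowerSeries ℤ_[p] ≃+* MvPowerSeries (Fin 1) ℤ_[p] :=
    (MvPowerSeries.renameEquiv ℤ_[p] (finOneEquiv.symm : Unit ≃ Fin 1)).toRingEquiv
  have hX : ∀ dd : Submodule.torsionBy (PowerSeries ℤ_[p]) A₂ c, c • dd = 0 := fun dd =>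
    Subtype.ext (by rw [Submodule.coe_smul, Submodule.coe_zero]; exact (Submodule.mem_torsionBy_iff _ _).1 dd.2)
  have hH := module_finite_characterModule_h1_absInertia_of_smul_eq_zero e ρDw ρZ hρZ c hc𝔪 hX hD hfinZ
  -- brick 2: the invariants quotient `A₂^{I_w}/X·A₂^{I_w}` has finitely generated dual
  let ρAI : ContinuousRep (absInertia (w.adicCompletion K)) (PowerSeries ℤ_[p]) A₂ :=
    (ρ.restrict (absGaloisRestrict K (w.adicCompletion K))).restrict
      (Literature.NumberTheory.GaloisRepresentations.subgroupIncl (absInertia (w.adicCompletion K)))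
  have hH' : Module.Finite (PowerSeries ℤ_[p])
      (CharacterModule (continuousCohomology 1 (torsionRep ρAI c).toTopRep)) := hH
  have hQ := TelescopeK2InvariantsQuotToH1.finite_characterModule_invariantsQuot_of_h1 ρAI c hcof hH'
  have hV : ρAI.toTopRep.ρ.invariants =
      ⨅ h : LocalGroup K (Sum.inr w), LinearMap.eqLocus (ρ (localMap K (Sum.inr w) h)) LinearMap.id := by
    ext a
    simp only [Submodule.mem_iInf, LinearMap.mem_eqLocus, LinearMap.id_apply]
    exact ⟨fun ha h => ha h, fun ha h => ha h⟩
  rw [hV] at hQ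
  -- brick 1: Cayley–Hamilton through Pontryagin duality
  exact TelescopeK2FrobeniusAnnihilator.frobeniusAnnihilator_of_finite ρ c w d hQ


end Summit.BirchSwinnertonDyer.BirchSwinnertonDyer.Theorems.TelescopeK2FrobeniusAnnihilatorOfQuasiIso

end
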